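import Literature.NumberTheory.GelbartRogawski1991.LocalKudlaSplittingInjective
import Literature.NumberTheory.GelbartRogawski1991.LocalSplittingsDifferByCharacter
import HarnessLib

-- buildfix G11b-3 recipe (LEDGER B13-1/B13-3), as in the GelbartRogawski1991 siblings: elaborate sequentially so the
-- trailing `attribute [implicit_reducible]` block is in force at `.olean` export (inert for the kernel).
set_option Elab.async false

/-!
# Rigidity of Kudla's splitting of the doubled group: two `P_Δ`-normalised homomorphic sections over the same
# embedding coincide

Topic `NumberTheory/GelbartRogawski1991`; namespace `Literature.NumberTheory.GelbartRogawski1991.UnitaryDualPair.LocalSplitting`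
(that of `LocalUnitarySplittingDatum`, `LocalKudlaSplittingUniqueness`, `LocalKudlaSplittingInjective`).  KERNEL ONLY: theorems;
no definition, no named fact, no `sorry`.  Third leaf of the local uniqueness package of Kudla's splitting
`s_v : H(F_v) = U(J ⊕ −J)(F_v) →* S̃p_ψ(𝕎^𝔻_v)` ([GelbartRogawski1991, §3.1 Remark p. 457 L4–13]: «a compatible splitting is
unique up to a character `ν′`»; [Kudla1994, Thm. 3.1]: it is PINNED by its values on the Siegel parabolic `P_Δ`), written for the
«⇐» direction of [Liu2021, App. D Lem. D.1 (3)] (cell `hodgecm-mathlib`, line a4-liuD3, stub `stub_iso_of_params`: the carriers of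
two members with the same parameters must be identified; step S6a «the `μ`-splitting is natural under the local isometry of two
lines of the same class»), where sections TRANSPORTED from other models must be compared with the constructed ones — so the
normalisation is phrased on OPERATORS, free of any Leray section:

* §1 (generic `S̃p_ψ`) `MpPsi.toRep_conj_eq_of_implements` — the conjugate `ω(m x m⁻¹)` is computed through ANY implementer `M`
  of `π(m)` (`= M ∘ ω(x) ∘ M⁻¹`; implementers are unique up to a scalar, which cancels); hence it depends on `m` only through
  `π(m)` (`MpPsi.toRep_conj_eq_of_proj_eq`), and for a `LocalSplittingDatum` `D` the parabolic normalisation printed with Rao's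
  operator `r(δ′)` (`localSplittingDatumCM_parabolic`, `L8_parabolicNormalised`) IS the operator statement
  `(ω(m s(p) m⁻¹) Φ)(0) = c(p) Φ(0)` for every `m` over `δ′` (`LocalSplittingDatum.toRep_conj_localSplitting_apply`);
* §2 **`eq_of_parabolic_toRep_conj_eq`** — two homomorphisms `s, s' : H(F_v) →* S̃p_ψ(𝕎^𝔻_v)` with the same projection, both
  satisfying `(ω(m s(p) m⁻¹) Φ)(0) = c(p) Φ(0)` on `P_Δ(F_v)` for one `m` and one scalar function `c` non-vanishing on `P_Δ`, are
  EQUAL as soon as every character of `H(F_v)` trivial on `P_Δ(F_v)` is trivial (`hκ`): `s' = κ ⊗ s` (torsor lemma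
  `MpPsi.exists_character_of_proj_eq`), `κ(p) c(p) 1_𝒪(0) = c(p) 1_𝒪(0)` forces `κ|_{P_Δ} = 1`;
* §3 **`hκ` at a NON-SPLIT place** (`eq_one_of_forall_isSiegelDelta_eq_one`, diagonal `T₀`, `n ≥ 1`): a character kills the
  elements of determinant one (`doubled_localPi_apply_eq_one_of_det_eq_one`, [Dieudonne1971GroupesClassiques, Chap. II §5]) and
  `det P_Δ(F_v) = det H(F_v)`: `det h` has norm one, every norm-one `λ` of the field `E ⊗ F_v` is `z · (σ z)⁻¹`
  (`exists_unit_eq_mul_conj_inv`: `z = 1 + λ`, or `z = δ` when `λ = -1` — Hilbert 90 for a quadratic extension by hand), and the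
  Siegel Levi element `m(z, 1, …, 1)` has determinant `z (σ z)⁻¹` (`exists_isSiegelDelta_det_eq`);
* §4 bookkeeping used by the consumers: `IsSiegelDelta` does not depend on the trace-zero element `δ` (`isSiegelDelta_iff_of_delta`),
  and the normalising scalar `χ_v(det_Δ p)⁻¹ · ∏_w ‖det_Δ p_w‖_w^{1/2}` does not vanish on `P_Δ` (`parabolicScalar_ne_zero`).

## References
* [GelbartRogawski1991] S. Gelbart, J. Rogawski, Invent. Math. 105 (1991), §3.1 Prop. 3.1.1 p. 455, Remark p. 457 L4–13.
* [Kudla1994] S. Kudla, Israel J. Math. 87 (1994), §3, Thm. 3.1.  [HarrisKudlaSweet1996] M. Harris, S. Kudla, W. Sweet, J. AMS 9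
  (1996), §1 (1.11)–(1.16).
* [MoeglinVignerasWaldspurger1987] C. Mœglin, M.-F. Vignéras, J.-L. Waldspurger, LNM 1291 (1987), Chap. 2 II.1.
* [Dieudonne1971GroupesClassiques] J. Dieudonné, *La géométrie des groupes classiques* (1971), Chap. II §5.
* [Liu2021] Y. Liu, Camb. J. Math. 9 (2021), App. D Lem. D.1 (3) (l. 5233).
-/

set_option autoImplicit false

noncomputable section

open NumberField IsDedekindDomain MeasureTheory Matrix
open Literature.RepresentationTheory.HeisenbergGroup
open Literature.NumberTheory.Automorphic Literature.NumberTheory.Automorphic.UnitaryGroup Literature.NumberTheory.Weil1964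
open Literature.NumberTheory.GelbartRogawski1991.AdaptedBlocks

/-! ## §1 Conjugation in `S̃p_ψ` computed through any implementer -/

namespace Literature.RepresentationTheory.HeisenbergGroup

section ConjImplementer

variable {R : Type*} [CommRing R] [Invertible (2 : R)] {V : Type*} [AddCommGroup V] [Module R V]
  {B : V →ₗ[R] V →ₗ[R] R} {k : Type*} [Field k] {S : Type*} [AddCommGroup S] [Module k S]
  (ρ : Representation k (Heisenberg B) S)

/-- **`ω(m x m⁻¹) = M ∘ ω(x) ∘ M⁻¹` for ANY implementer `M` of `π(m)`**: the operator of `m` is `a • M` for a scalar `a`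
(uniqueness of implementers up to a scalar), and the scalar cancels in the conjugation.
[cite: MoeglinVignerasWaldspurger1987, Chap. 2 II.1 (A)] -/
theorem MpPsi.toRep_conj_eq_of_implements (hU : ImplementerUniqueUpToScalar ρ) (m x : MpPsi ρ) (M : S ≃ₗ[k] S)
    (hM : Implements ρ (ofSymplectic B (MpPsi.proj ρ m)) M) (f : S) :
    MpPsi.toRep ρ (m * x * m⁻¹) f = M (MpPsi.toRep ρ x (M.symm f)) := by
  obtain ⟨a, ha⟩ := hU (MpPsi.proj ρ m) M (MpPsi.toOp ρ m) hM (MpPsi.toRep_implements ρ m)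
  have hsymm : ∀ g : S, (MpPsi.toOp ρ m).symm g = ((a⁻¹ : kˣ) : k) • M.symm g := fun g => by
    apply (MpPsi.toOp ρ m).injective
    rw [LinearEquiv.apply_symm_apply, map_smul, ha, M.apply_symm_apply, smul_smul, Units.inv_mul, one_smul]
  rw [MpPsi.toRep_apply, MpPsi.toRep_apply, Subgroup.coe_mul, Subgroup.coe_mul, Subgroup.coe_inv, Prod.snd_mul,
    Prod.snd_mul, Prod.snd_inv, LinearEquiv.mul_apply, LinearEquiv.mul_apply, LinearEquiv.coe_inv]
  change MpPsi.toOp ρ m (((x : symplecticGroup B × (S ≃ₗ[k] S)).2) ((MpPsi.toOp ρ m).symm f)) = _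
  rw [hsymm, map_smul, ha, map_smul, smul_smul, Units.mul_inv, one_smul]

/-- hence `ω(m x m⁻¹)` depends on `m` only through `π(m)`. [cite: MoeglinVignerasWaldspurger1987, Chap. 2 II.1 (A)] -/
theorem MpPsi.toRep_conj_eq_of_proj_eq (hU : ImplementerUniqueUpToScalar ρ) (m m' x : MpPsi ρ)
    (h : MpPsi.proj ρ m' = MpPsi.proj ρ m) : MpPsi.toRep ρ (m' * x * m'⁻¹) = MpPsi.toRep ρ (m * x * m⁻¹) := by
  refine LinearMap.ext fun f => ?_
  have hM : Implements ρ (ofSymplectic B (MpPsi.proj ρ m')) (MpPsi.toOp ρ m) := by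
    rw [h]; exact MpPsi.toRep_implements ρ m
  rw [MpPsi.toRep_conj_eq_of_implements ρ hU m' x (MpPsi.toOp ρ m) hM f,
    MpPsi.toRep_conj_eq_of_implements ρ hU m x (MpPsi.toOp ρ m) (MpPsi.toRep_implements ρ m) f]

/-- central scalars pass through a conjugation: `m (i(a) x) m⁻¹ = i(a) (m x m⁻¹)`. [cite: MoeglinVignerasWaldspurger1987, Chap. 2 II.1 (B)] -/
theorem MpPsi.conj_ofScalar_mul (m x : MpPsi ρ) (a : kˣ) :
    m * (MpPsi.ofScalar ρ a * x) * m⁻¹ = MpPsi.ofScalar ρ a * (m * x * m⁻¹) := by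
  have hc : m * MpPsi.ofScalar ρ a = MpPsi.ofScalar ρ a * m :=
    Subgroup.mem_center_iff.1 (MpPsi.ofScalar_mem_center ρ a) m
  rw [← mul_assoc m, hc, mul_assoc (MpPsi.ofScalar ρ a), mul_assoc (MpPsi.ofScalar ρ a), mul_assoc m]

end ConjImplementer

end Literature.RepresentationTheory.HeisenbergGroup

namespace Literature.NumberTheory.GelbartRogawski1991.UnitaryDualPair.LocalSplitting

variable (F : Type) [Field F] [NumberField F] (E : Type) [Field E] [NumberField E] [Algebra F E]
  [Algebra.IsQuadraticExtension F E] (c : E ≃ₐ[F] E)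
  {δ : E} (hcδ : c δ = -δ) (hδ : δ ≠ 0) {d : F} (hd : δ * δ = algebraMap F E d)
  (v : HeightOneSpectrum (𝓞 F))

/-! ## §2 Rigidity: a `P_Δ`-normalised homomorphic section over a given embedding is unique -/

section Rigidity

variable (n : ℕ) {T₀ : Matrix (Fin n) (Fin n) F} {JD : Matrix (Fin (n + n)) (Fin (n + n)) E}

/-- **RIGIDITY OF THE `P_Δ`-NORMALISED SPLITTING.**  Let `s, s' : H(F_v) →* S̃p_ψ(𝕎^𝔻_v)` be homomorphisms with the same
projection to `Sp(𝕎^𝔻_v)`, and suppose that for ONE `m ∈ S̃p_ψ(𝕎^𝔻_v)` and one scalar function `c` non-vanishing on `P_Δ(F_v)` both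
satisfy the parabolic normalisation `(ω(m s(p) m⁻¹) Φ)(0) = c(p) · Φ(0)` (`p ∈ P_Δ(F_v)`, all `Φ`).  If every character of `H(F_v)`
trivial on `P_Δ(F_v)` is trivial (`hκ`), then `s' = s`: the torsor character `κ = s'/s` (`MpPsi.exists_character_of_proj_eq`)
satisfies `κ(p) c(p) = c(p)` on `P_Δ` (evaluate at `Φ = 1_{𝒪^{n+n}}`, `Φ(0) = 1`).
[cite: GelbartRogawski1991, §3.1 Remark p. 457 L4–13] [cite: Kudla1994, Thm 3.1] -/
theorem eq_of_parabolic_toRep_conj_eq (hT₀ : T₀.IsSymm) (hT₀d : IsUnit T₀.det)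
    (hJD : JD = (gramD F n T₀).map (algebraMap F E))
    (s s' : UnitaryGroup.localPi E c (n + n) JD v →* LocalMp F (n + n) (gramD F n T₀) v)
    (hss' : ∀ g, MpPsi.proj _ (s' g) = MpPsi.proj _ (s g))
    (hκ : ∀ θ : UnitaryGroup.localPi E c (n + n) JD v →* ℂˣ,
      (∀ p, IsSiegelDelta F E c hcδ hδ hd v n hT₀ hJD p → θ p = 1) → θ = 1)
    (cΔ : UnitaryGroup.localPi E c (n + n) JD v → ℂ) (hc : ∀ p, IsSiegelDelta F E c hcδ hδ hd v n hT₀ hJD p → cΔ p ≠ 0)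
    (m : LocalMp F (n + n) (gramD F n T₀) v)
    (hs : ∀ p, IsSiegelDelta F E c hcδ hδ hd v n hT₀ hJD p → ∀ Φ : SchwartzBruhat (Fin (n + n) → v.adicCompletion F),
      ((MpPsi.toRep _ (m * s p * m⁻¹) Φ : SchwartzBruhat (Fin (n + n) → v.adicCompletion F)) :
        (Fin (n + n) → v.adicCompletion F) → ℂ) 0 = cΔ p * (Φ : (Fin (n + n) → v.adicCompletion F) → ℂ) 0)
    (hs' : ∀ p, IsSiegelDelta F E c hcδ hδ hd v n hT₀ hJD p → ∀ Φ : SchwartzBruhat (Fin (n + n) → v.adicCompletion F),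
      ((MpPsi.toRep _ (m * s' p * m⁻¹) Φ : SchwartzBruhat (Fin (n + n) → v.adicCompletion F)) :
        (Fin (n + n) → v.adicCompletion F) → ℂ) 0 = cΔ p * (Φ : (Fin (n + n) → v.adicCompletion F) → ℂ) 0) :
    s' = s := by
  haveI : Nontrivial (SchwartzBruhat (Fin (n + n) → v.adicCompletion F)) := nontrivial_schwartzBruhat_pi
  have hex : ∃ η : UnitaryGroup.localPi E c (n + n) JD v →* ℂˣ,
      ∀ g, s' g = MpPsi.ofScalar (localSchrodinger F (n + n) (gramD F n T₀) v) (η g) * s g :=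
    MpPsi.exists_character_of_proj_eq (localSchrodinger F (n + n) (gramD F n T₀) v)
      (implementerUniqueUpToScalar_localSchrodinger F (n + n) (gramD F n T₀) (isUnit_det_gramD F n hT₀d) v) s s' hss'
  obtain ⟨η, hη⟩ := hex
  have hη1 : ∀ p, IsSiegelDelta F E c hcδ hδ hd v n hT₀ hJD p → η p = 1 := by
    intro p hp
    have h0 : ((unitVec F (Fin (n + n)) v : SchwartzBruhat (Fin (n + n) → v.adicCompletion F)) :
        (Fin (n + n) → v.adicCompletion F) → ℂ) 0 = 1 :=
      unitVec_apply_of_mem fun i _ => (v.adicCompletionIntegers F).zero_mem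
    have A := hs p hp (unitVec F (Fin (n + n)) v)
    have A' := hs' p hp (unitVec F (Fin (n + n)) v)
    rw [hη p, MpPsi.conj_ofScalar_mul, MpPsi.toRep_ofScalar_mul, Submodule.coe_smul, Pi.smul_apply, smul_eq_mul, A, h0,
      mul_one] at A'
    exact Units.val_eq_one.1 (mul_eq_right₀ (hc p hp) |>.1 A')
  have hη' : η = 1 := hκ η hη1
  refine MonoidHom.ext fun g => ?_
  rw [hη g, hη', MonoidHom.one_apply, map_one, one_mul]

end Rigidity

/-! ## §3 At a non-split place every character of `H(F_v)` trivial on `P_Δ(F_v)` is trivial -/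

section NonSplit

variable (n : ℕ) {T₀ : Matrix (Fin n) (Fin n) F} {JD : Matrix (Fin (n + n)) (Fin (n + n)) E}

omit [Algebra.IsQuadraticExtension F E] in
include hcδ hδ in
/-- **Hilbert 90 for the quadratic extension `E ⊗ F_v / F_v` at a non-split place, by hand**: a norm-one element `λ`
(`σλ · λ = 1`) is `z / σz` for a unit `z` — `z = 1 + λ` (`λ(1 + σλ) = λ + 1`), or `z = δ` when `λ = -1` (`σδ = -δ`).
[cite: Dieudonne1971GroupesClassiques, Chap. II §5] -/
theorem exists_unit_mul_conj_eq (hE : IsField (LocalRing E v)) (lam : LocalRing E v)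
    (hlam : conjLocal E c v lam * lam = 1) : ∃ z : (LocalRing E v)ˣ, lam * conjLocal E c v z = z := by
  classical
  letI : Field (LocalRing E v) := hE.toField
  by_cases h1 : 1 + lam = 0
  · have hlam1 : lam = -1 := by linear_combination h1
    have hδ0 : algebraMap E (LocalRing E v) δ ≠ 0 := (map_ne_zero _).2 hδ
    refine ⟨Units.mk0 _ hδ0, ?_⟩
    rw [Units.val_mk0, conjLocal_algebraMap, hcδ, map_neg, hlam1, neg_one_mul, neg_neg]
  · refine ⟨Units.mk0 _ h1, ?_⟩
    rw [Units.val_mk0, map_add, map_one]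
    linear_combination hlam

omit [Algebra.IsQuadraticExtension F E] in
/-- `det h` has norm one for `h ∈ H(F_v)` (`h` is unitary for `J ⊕ −J`, whose determinant is a unit).
[cite: Dieudonne1971GroupesClassiques, Chap. II §5] -/
theorem conj_det_mul_det_eq_one (hT₀d : IsUnit T₀.det) (hJD : JD = (gramD F n T₀).map (algebraMap F E))
    (h : UnitaryGroup.localPi E c (n + n) JD v) :
    conjLocal E c v
        ((UnitaryGroup.localPiEquiv E c (n + n) JD v h : UnitaryGroup.«local» E c (n + n) JD v) :
          GL (Fin (n + n)) (LocalRing E v)).1.det *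
      ((UnitaryGroup.localPiEquiv E c (n + n) JD v h : UnitaryGroup.«local» E c (n + n) JD v) :
        GL (Fin (n + n)) (LocalRing E v)).1.det = 1 := by
  set ι : F →+* LocalRing E v := (algebraMap E (LocalRing E v)).comp (algebraMap F E) with hι
  have hH : (UnitaryGroup.adelicForm E (n + n) JD).map (adeleToLocal E v) = (gramD F n T₀).map ι := by
    rw [UnitaryGroup.adelicForm, hJD, Matrix.map_map, Matrix.map_map]
    rfl
  have hJu : IsUnit ((UnitaryGroup.adelicForm E (n + n) JD).map (adeleToLocal E v)).det := by
    rw [hH, ← RingHom.mapMatrix_apply, ← RingHom.map_det]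
    exact (isUnit_det_gramD F n hT₀d).map _
  have hg := mem_unitaryGroupOfForm_iff.1 (UnitaryGroup.localPiEquiv E c (n + n) JD v h).2
  have hd' := congrArg Matrix.det hg
  rw [Matrix.det_mul, Matrix.det_mul, Matrix.det_transpose, ← RingHom.mapMatrix_apply, ← RingHom.map_det] at hd'
  refine hJu.mul_right_cancel ?_
  rw [one_mul]
  linear_combination hd'

include hcδ hδ hd in
/-- **Siegel Levi elements with prescribed determinant** (diagonal `T₀`, `n ≥ 1`): for a unit `z` of `E ⊗ F_v` the element
`m(z) = ofAdapted (diag(z,1,…,1) ⊕ diag(σz,1,…,1)⁻¹)` lies in `P_Δ(F_v)` and `det m(z) · σz = z`.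
[cite: Kudla1994, §3] [cite: HarrisKudlaSweet1996, §1 (1.11)] -/
theorem exists_isSiegelDelta_det_eq (hn : 0 < n) (t : Fin n → F) (hT₀t : T₀ = Matrix.diagonal t) (hT₀ : T₀.IsSymm)
    (hJD : JD = (gramD F n T₀).map (algebraMap F E)) (z : (LocalRing E v)ˣ) :
    ∃ p : UnitaryGroup.localPi E c (n + n) JD v, IsSiegelDelta F E c hcδ hδ hd v n hT₀ hJD p ∧
      ((UnitaryGroup.localPiEquiv E c (n + n) JD v p : UnitaryGroup.«local» E c (n + n) JD v) :
          GL (Fin (n + n)) (LocalRing E v)).1.det * conjLocal E c v z = z := by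
  classical
  subst hT₀t
  set σ := conjLocal E c v with hσdef
  have hσσ : ∀ x, σ (σ x) = x := conjLocal_conjLocal' F E c hcδ hδ hd v
  set dd : Fin n → (LocalRing E v)ˣ := fun i => if i = ⟨0, hn⟩ then z else 1 with hdd
  set A : Matrix (Fin n) (Fin n) (LocalRing E v) := Matrix.diagonal fun i => (dd i : LocalRing E v) with hA
  set Dm : Matrix (Fin n) (Fin n) (LocalRing E v) := Matrix.diagonal fun i => σ ((dd i)⁻¹ : (LocalRing E v)ˣ) with hDm
  -- the form block `S = 2 · diag(t)` is diagonal and real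
  set sdiag : Fin n → LocalRing E v := fun i => (2 : LocalRing E v) * toLocalRing E v (algebraMap F _ (t i)) with hs
  have hS : (2 : LocalRing E v) • gramS F E v n (Matrix.diagonal t) = Matrix.diagonal sdiag := by
    dsimp only [gramS]
    rw [Matrix.diagonal_map (map_zero _), Matrix.diagonal_map (map_zero _), ← Matrix.diagonal_smul]
    rfl
  have hY : ((Matrix.fromBlocks A 0 0 Dm).map σ)ᵀ * adForm F E v n (T₀ := Matrix.diagonal t) * Matrix.fromBlocks A 0 0 Dm =
      adForm F E v n (T₀ := Matrix.diagonal t) := by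
    dsimp only [adForm]
    rw [hS, Matrix.fromBlocks_map, Matrix.fromBlocks_transpose, hA, hDm, Matrix.diagonal_map (map_zero σ),
      Matrix.diagonal_map (map_zero σ), Matrix.diagonal_transpose, Matrix.diagonal_transpose,
      Matrix.map_zero σ (map_zero σ), Matrix.transpose_zero, Matrix.fromBlocks_multiply, Matrix.fromBlocks_multiply]
    simp only [Matrix.zero_mul, Matrix.mul_zero, add_zero, zero_add, Matrix.diagonal_mul_diagonal]
    refine Matrix.fromBlocks_inj.2 ⟨rfl, ?_, ?_, rfl⟩
    · congr 1
      funext i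
      rw [mul_right_comm, ← map_mul, Units.mul_inv, map_one, one_mul]
    · congr 1
      funext i
      rw [hσσ, mul_right_comm, Units.inv_mul, one_mul]
  have hdetY : (Matrix.fromBlocks A 0 0 Dm).det = (z : LocalRing E v) * σ ((z⁻¹ : (LocalRing E v)ˣ) : LocalRing E v) := by
    rw [Matrix.det_fromBlocks_zero₂₁, hA, hDm, Matrix.det_diagonal, Matrix.det_diagonal, ← map_prod σ, ← Units.coe_prod,
      ← Units.coe_prod]
    simp only [hdd, Finset.prod_inv_distrib, Fintype.prod_ite_eq']
  have hYu : IsUnit (Matrix.fromBlocks A 0 0 Dm).det := by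
    rw [hdetY]
    exact (Units.isUnit z).mul ((Units.isUnit z⁻¹).map σ)
  refine ⟨ofAdapted F E c v n hJD _ hYu hY, isSiegelDelta_ofAdapted_fromBlocks F E c hcδ hδ hd v n hT₀ hJD A 0 Dm hYu hY, ?_⟩
  -- `det m(z) = det Y = z · σ(z⁻¹)`
  have hdet : ((UnitaryGroup.localPiEquiv E c (n + n) JD v (ofAdapted F E c v n hJD _ hYu hY) :
      UnitaryGroup.«local» E c (n + n) JD v) : GL (Fin (n + n)) (LocalRing E v)).1.det = (Matrix.fromBlocks A 0 0 Dm).det := by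
    have e1 : (matA F E c v n (ofAdapted F E c v n hJD _ hYu hY)).det =
        ((UnitaryGroup.localPiEquiv E c (n + n) JD v (ofAdapted F E c v n hJD _ hYu hY) :
          UnitaryGroup.«local» E c (n + n) JD v) : GL (Fin (n + n)) (LocalRing E v)).1.det := by
      rw [matA, Matrix.reindex_apply, Matrix.det_submatrix_equiv_self]
    rw [← e1, matA_ofAdapted, Matrix.det_mul, Matrix.det_mul, mul_right_comm, ← Matrix.det_mul, cayR_mul_cayRinv,
      Matrix.det_one, one_mul]
  rw [hdet, hdetY, mul_assoc, ← map_mul, Units.inv_mul, map_one, mul_one]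

include hcδ hδ hd in
/-- **at a NON-SPLIT place every homomorphism `H(F_v) →* A` (`A` commutative) which is trivial on `P_Δ(F_v)` is trivial**
(diagonal `T₀`, `n ≥ 1`): `θ` kills `SU` (`doubled_localPi_apply_eq_one_of_det_eq_one`) and every `det h` (norm one) is the
determinant of a Siegel Levi element (`exists_unit_mul_conj_eq`, `exists_isSiegelDelta_det_eq`), so `h = (h m⁻¹) m` with
`det (h m⁻¹) = 1`, `m ∈ P_Δ`. [cite: Dieudonne1971GroupesClassiques, Chap. II §5] [cite: Kudla1994, Thm 3.1] -/
theorem eq_one_of_forall_isSiegelDelta_eq_one (hn : 0 < n) (t : Fin n → F) (hT₀t : T₀ = Matrix.diagonal t)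
    (hT₀ : T₀.IsSymm) (hT₀d : IsUnit T₀.det) (hJD : JD = (gramD F n T₀).map (algebraMap F E))
    (hE : IsField (LocalRing E v)) {A : Type*} [CommGroup A] (θ : UnitaryGroup.localPi E c (n + n) JD v →* A)
    (hθ : ∀ p, IsSiegelDelta F E c hcδ hδ hd v n hT₀ hJD p → θ p = 1) : θ = 1 := by
  classical
  letI : Field (LocalRing E v) := hE.toField
  refine MonoidHom.ext fun h => ?_
  set ψ := UnitaryGroup.localPiEquiv E c (n + n) JD v with hψ
  -- `det h = z / σ z` and the Levi element of that determinant
  obtain ⟨z, hz⟩ := exists_unit_mul_conj_eq F E c hcδ hδ v hE _ (conj_det_mul_det_eq_one F E c v n hT₀d hJD h)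
  obtain ⟨p, hp, hpdet⟩ := exists_isSiegelDelta_det_eq F E c hcδ hδ hd v n hn t hT₀t hT₀ hJD z
  have hσz : conjLocal E c v z ≠ 0 := fun h0 => z.ne_zero (by
    rw [← conjLocal_conjLocal' F E c hcδ hδ hd v (z : LocalRing E v), h0, map_zero])
  have hdet : ((ψ p : UnitaryGroup.«local» E c (n + n) JD v) : GL (Fin (n + n)) (LocalRing E v)).1.det =
      ((ψ h : UnitaryGroup.«local» E c (n + n) JD v) : GL (Fin (n + n)) (LocalRing E v)).1.det :=
    mul_right_cancel₀ hσz (hpdet.trans hz.symm)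
  have hu : Matrix.GeneralLinearGroup.det ((ψ p : UnitaryGroup.«local» E c (n + n) JD v) : GL (Fin (n + n)) (LocalRing E v)) =
      Matrix.GeneralLinearGroup.det ((ψ h : UnitaryGroup.«local» E c (n + n) JD v) : GL (Fin (n + n)) (LocalRing E v)) :=
    Units.ext hdet
  have h2 : θ (h * p⁻¹) = 1 := by
    refine doubled_localPi_apply_eq_one_of_det_eq_one F E c hcδ hδ hd v n hT₀ hT₀d hJD hn hE θ _ ?_
    rw [map_mul, map_inv, Subgroup.coe_mul, Subgroup.coe_inv, map_mul, map_inv, hu, mul_inv_cancel]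
  have e : h = h * p⁻¹ * p := by rw [inv_mul_cancel_right]
  rw [e, map_mul, h2, hθ p hp, one_mul, MonoidHom.one_apply]

end NonSplit

/-! ## §4 Bookkeeping for the consumers: `IsSiegelDelta` is `δ`-free; the normalising scalar does not vanish on `P_Δ` -/

section Bookkeeping

variable (n : ℕ) {T₀ : Matrix (Fin n) (Fin n) F} {JD : Matrix (Fin (n + n)) (Fin (n + n)) E}

/-- **`P_Δ(F_v)` does not depend on the trace-zero element `δ`** used to realise `ι^𝔻_v` (nor on `T₀`): it is the block
condition `h₁₁ + h₁₂ = h₂₁ + h₂₂` at every `w ∣ v` (`isSiegelDelta_iff_blocks`). [cite: Kudla1994, §3] [cite: HarrisKudlaSweet1996, §1 (1.11)] -/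
theorem isSiegelDelta_iff_of_delta {δ' : E} (hcδ' : c δ' = -δ') (hδ' : δ' ≠ 0) {d' : F} (hd' : δ' * δ' = algebraMap F E d')
    (hT₀ : T₀.IsSymm) {T₀' : Matrix (Fin n) (Fin n) F} (hT₀' : T₀'.IsSymm)
    (hJD : JD = (gramD F n T₀).map (algebraMap F E)) (hJD' : JD = (gramD F n T₀').map (algebraMap F E))
    (h : UnitaryGroup.localPi E c (n + n) JD v) :
    IsSiegelDelta F E c hcδ' hδ' hd' v n hT₀' hJD' h ↔ IsSiegelDelta F E c hcδ hδ hd v n hT₀ hJD h := by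
  rw [isSiegelDelta_iff_blocks, isSiegelDelta_iff_blocks]

/-- `det_Δ p_w ≠ 0` for `p ∈ P_Δ(F_v)` (`det p_w = det A · det D` is a unit). [cite: Kudla1994, §3] -/
theorem detDelta_ne_zero (hT₀ : T₀.IsSymm) (hJD : JD = (gramD F n T₀).map (algebraMap F E))
    {p : UnitaryGroup.localPi E c (n + n) JD v} (hp : IsSiegelDelta F E c hcδ hδ hd v n hT₀ hJD p) (w : PlacesOver E v) :
    detDelta F E c v n w p ≠ 0 := by
  have hdet := det_eq_det_blkA_mul_det_blkD F E c hcδ hδ hd v n hT₀ hJD hp w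
  have hu : (((p : UnitaryGroup.LocalGLPi E (n + n) v) w : GL (Fin (n + n)) (w.1.adicCompletion E)) :
      Matrix (Fin (n + n)) (Fin (n + n)) (w.1.adicCompletion E)).det ≠ 0 := by
    rw [← Matrix.GeneralLinearGroup.val_det_apply]
    exact Units.ne_zero _
  rw [hdet] at hu
  rw [detDelta_eq_det_blkA F E c hcδ hδ hd v n hT₀ hJD hp w]
  exact left_ne_zero_of_mul hu

/-- **the normalising scalar `χ_v(det_Δ p)⁻¹ · ∏_{w ∣ v} ‖det_Δ p_w‖_w^{1/2}` does not vanish on `P_Δ(F_v)`.**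
[cite: Kudla1994, Thm 3.1] [cite: HarrisKudlaSweet1996, §1 (1.16)] -/
theorem parabolicScalar_ne_zero (hT₀ : T₀.IsSymm) (hJD : JD = (gramD F n T₀).map (algebraMap F E))
    (χv : ∀ w : PlacesOver E v, (w.1.adicCompletion E)ˣ →* ℂˣ)
    {p : UnitaryGroup.localPi E c (n + n) JD v} (hp : IsSiegelDelta F E c hcδ hδ hd v n hT₀ hJD p) :
    (((chiDet F E c v n χv p)⁻¹ : ℂˣ) : ℂ) *
        ((∏ w : PlacesOver E v, Real.sqrt ‖detDelta F E c v n w p‖ : ℝ) : ℂ) ≠ 0 := by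
  refine mul_ne_zero (Units.ne_zero _) ?_
  rw [Complex.ofReal_ne_zero, Finset.prod_ne_zero_iff]
  intro w _
  exact (Real.sqrt_pos.2 (norm_pos_iff.2 (detDelta_ne_zero F E c hcδ hδ hd v n hT₀ hJD hp w))).ne'

end Bookkeeping

/-! ## §5 A `LocalSplittingDatum`'s parabolic normalisation in operator form -/

section Datum

variable {N : ℕ} {T : Matrix (Fin N) (Fin N) F} {hT : T.IsSymm} {hTd : IsUnit T.det}
  {J : Matrix (Fin N) (Fin N) E} {hJ : J = T.map (algebraMap F E)}
  [MeasurableSpace (v.adicCompletion F)] [BorelSpace (v.adicCompletion F)]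
  {μ : Measure (v.adicCompletion F)} [μ.IsAddHaarMeasure]
  {ℓ : Submodule (v.adicCompletion F) ((Fin N → v.adicCompletion F) × (Fin N → v.adicCompletion F))}
  {hℓ : LinearMap.BilinForm.orthogonal (alt (polar (localPairing F N T v))) ℓ = ℓ}
  (D : LocalSplittingDatum F E c N hcδ hδ hd T hT hTd hJ v μ ℓ hℓ)

/-- **conjugating `s_v(g)` by ANY `m` over `δ′ = π(m)` is conjugating `ω_v(g)` by Rao's operator `r(δ′)`**:
`ω(m s_v(g) m⁻¹) Φ = r(δ′) (ω_v(g) (r(δ′)⁻¹ Φ))` — so the parabolic normalisation of a datum, printed with `r(δ′)`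
(`localSplittingDatumCM_parabolic`), is a statement about the section `s_v` alone.
[cite: MoeglinVignerasWaldspurger1987, Chap. 2 II.1 (A)] [cite: Kudla1994, Thm 3.1] -/
theorem LocalSplittingDatum.toRep_conj_localSplitting_apply (m : LocalMp F N T v) (g : UnitaryGroup.localPi E c N J v)
    (Φ : SchwartzBruhat (Fin N → v.adicCompletion F)) :
    MpPsi.toRep _ (m * D.localSplitting g * m⁻¹) Φ = (D.r (MpPsi.proj _ m)) (D.localOmega g ((D.r (MpPsi.proj _ m)).symm Φ)) :=
  MpPsi.toRep_conj_eq_of_implements _ D.hU m (D.localSplitting g) (D.r (MpPsi.proj _ m)) (D.r.implements _) Φ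

end Datum

/-! ### Build-lane note (ops-buildfix G11b-3 recipe, LEDGER B13-1, 2026-08-21)
As in the `LocalDoubledUnitary*` / `LocalKudlaSplitting*` siblings: the public theorems with very large dependent binder
telescopes are tagged `[implicit_reducible]` ONLY to keep them out of `lean -o`'s library-suggestion index (inert for the
kernel; no statement or proof is changed). -/
set_option allowUnsafeReducibility true in
attribute [implicit_reducible]
  eq_of_parabolic_toRep_conj_eq conj_det_mul_det_eq_one exists_isSiegelDelta_det_eq eq_one_of_forall_isSiegelDelta_eq_one
  isSiegelDelta_iff_of_delta detDelta_ne_zero parabolicScalar_ne_zero LocalSplittingDatum.toRep_conj_localSplitting_apply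

end Literature.NumberTheory.GelbartRogawski1991.UnitaryDualPair.LocalSplitting

end
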